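import Literature.NumberTheory.LFunctions.SchoenfeldZerosLow
import Literature.NumberTheory.LFunctions.SchoenfeldPsiSmall
import HarnessLib

/-!
# `ψ(y) ≤ 1.04 y` under RH, and `ψ(x) − θ(x) ≤ 1.04 (√x + x^{1/3} + x^{1/5})`

Topic: `Literature/NumberTheory/LFunctions`. THEOREMS (everything proved). Auxiliary input to the
discharge of `Literature.NumberTheory.LFunctions.schoenfeld_explicit` (Schoenfeld 1976, Cor. 1), where `θ` and `π` are
reached from `ψ` through `ψ(x) − θ(x) ≤ ψ(√x) + ψ(x^{1/3}) + ψ(x^{1/5})`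
(`Chebyshev.psi_sub_theta_le_psi_add_psi_add_psi`; Rosser–Schoenfeld 1962 use their Theorem 12,
`ψ(x) < 1.03883 x`, and (3.39) `ψ(x) − θ(x) < 1.02 √x + 3 x^{1/3}` at this point).

* `psi_le_mul` — **under RH, `ψ(y) ≤ 1.04 y` for all `y ≥ 0`**: for `y ≤ 10⁴` this is the kernel
  computation `psi_le_of_le_ten_thousand` (`SchoenfeldPsiSmall.lean`); for `y ≥ 10⁴` it is the
  differenced explicit formula `psi_sub_self_le` (`SchoenfeldPsiDifference.lean`) with `h = 2√y` and
  the zeros split at height `100`, using the certified sums `sumInvNorm 100 ≤ 1.1845`,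
  `β − sumInvNormSq 100 ≤ 0.011991` (`SchoenfeldZerosLow.lean`):
  `ψ(y) − y ≤ √y + 1.1845·√(1.0201 y) + 1.0201·1.01·0.011991·y + 1 ≤ 0.0354 y`.
* `psi_sub_theta_le` — under RH, `ψ(x) − θ(x) ≤ 1.04 (√x + x^{1/3} + x^{1/5})` for `x ≥ 0`.

## References

* J. B. Rosser, L. Schoenfeld, Illinois J. Math. 6 (1962), 64–94, Theorems 12–13, (3.39).
  [RosserSchoenfeld1962]
* L. Schoenfeld, Math. Comp. 30 (1976), 337–360, (6.13). [Schoenfeld1976]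
-/

noncomputable section

open Real
open scoped Chebyshev

namespace Literature.NumberTheory.LFunctions

namespace SchoenfeldBound

/-- `x^{3/2} = x √x` for `x ≥ 0`. [folklore] -/
theorem rpow_three_halves {x : ℝ} (hx : 0 ≤ x) : x ^ (3 / 2 : ℝ) = x * Real.sqrt x := by
  rw [show (3 / 2 : ℝ) = 1 + 1 / 2 by norm_num, Real.sqrt_eq_rpow]
  rcases hx.eq_or_lt with h | h
  · rw [← h, Real.zero_rpow (by norm_num)]; simp
  · rw [Real.rpow_add h, Real.rpow_one]

/-- **Under RH, `ψ(y) ≤ 1.04 y` for `y ≥ 10⁴`** (differenced explicit formula with `h = 2√y`, zeros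
split at height `100`). [cite: Schoenfeld1976, Thm. 10 (6.2) (method)] -/
theorem psi_le_mul_of_ge (hRH : RiemannHypothesis) {y : ℝ} (hy : 10000 ≤ y) : ψ y ≤ 1.04 * y := by
  have hy0 : 0 < y := by linarith
  have hs : 100 ≤ Real.sqrt y := by
    rw [show (100 : ℝ) = Real.sqrt (100 ^ 2) by rw [Real.sqrt_sq (by norm_num)]]
    exact Real.sqrt_le_sqrt (by linarith)
  have hs0 : 0 < Real.sqrt y := by linarith
  have hsy : Real.sqrt y * Real.sqrt y = y := Real.mul_self_sqrt hy0.le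
  set h : ℝ := 2 * Real.sqrt y with hh
  have hh0 : 0 < h := by positivity
  have hA := sumInvNorm_100_le
  have hB := tail_100_le
  have hmain := psi_sub_self_le hRH (x := y) (h := h) (by linarith) hh0 100
  -- `y + h ≤ 1.0201 y`, `√(y + h) ≤ 1.01 √y`
  have hyh : y + h ≤ 1.0201 * y := by rw [hh]; nlinarith
  have hsqrt : Real.sqrt (y + h) ≤ 1.01 * Real.sqrt y := by
    rw [show (1.01 : ℝ) * Real.sqrt y = Real.sqrt (1.01 ^ 2 * y) by
      rw [Real.sqrt_mul' _ hy0.le, Real.sqrt_sq (by norm_num)]]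
    exact Real.sqrt_le_sqrt (by nlinarith)
  have hyh0 : 0 ≤ y + h := by positivity
  -- the four terms
  have h1 : h / 2 ≤ 0.01 * y := by rw [hh]; nlinarith
  have h2 : Real.sqrt (y + h) * sumInvNorm 100 ≤ 0.0119635 * y := by
    calc Real.sqrt (y + h) * sumInvNorm 100 ≤ (1.01 * Real.sqrt y) * 1.1845 :=
          mul_le_mul hsqrt hA (sumInvNorm_nonneg _) (by positivity)
      _ ≤ 0.0119635 * y := by nlinarith
  have h3 : 2 * (y + h) ^ (3 / 2 : ℝ) / h * (nicolasBeta - sumInvNormSq 100) ≤ 0.012355 * y := by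
    rw [rpow_three_halves hyh0]
    have e : 2 * ((y + h) * Real.sqrt (y + h)) / h = (y + h) * Real.sqrt (y + h) / Real.sqrt y := by
      rw [hh]; field_simp
    rw [e]
    have htail : nicolasBeta - sumInvNormSq 100 ≤ 0.011991 := hB
    have hnn : 0 ≤ nicolasBeta - sumInvNormSq 100 := by
      linarith [sumInvNormSq_le_nicolasBeta hRH 100]
    have hq : (y + h) * Real.sqrt (y + h) / Real.sqrt y ≤ 1.0201 * y * 1.01 := by
      rw [div_le_iff₀ hs0]
      calc (y + h) * Real.sqrt (y + h) ≤ (1.0201 * y) * (1.01 * Real.sqrt y) :=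
            mul_le_mul hyh hsqrt (Real.sqrt_nonneg _) (by positivity)
        _ = 1.0201 * y * 1.01 * Real.sqrt y := by ring
    calc (y + h) * Real.sqrt (y + h) / Real.sqrt y * (nicolasBeta - sumInvNormSq 100)
        ≤ (1.0201 * y * 1.01) * 0.011991 := mul_le_mul hq htail hnn (by positivity)
      _ ≤ 0.012355 * y := by nlinarith
  have h4 : y / (2 * h * (y ^ 2 - 1)) ≤ 0.0001 * y := by
    have hy2 : y ≤ y ^ 2 - 1 := by nlinarith
    have hden : y ≤ 2 * h * (y ^ 2 - 1) := by
      have : 1 ≤ 2 * h := by rw [hh]; linarith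
      nlinarith
    have hpos : 0 < 2 * h * (y ^ 2 - 1) := by
      have : 0 < y ^ 2 - 1 := by nlinarith
      positivity
    have : y / (2 * h * (y ^ 2 - 1)) ≤ 1 := (div_le_one hpos).2 hden
    linarith
  have h5 : 0 < Real.log (2 * π) := Real.log_pos (by linarith [Real.pi_gt_three])
  linarith

/-- **Under RH, `ψ(y) ≤ 1.04 y` for every `y ≥ 0`** (kernel computation below `10⁴`,
`psi_le_mul_of_ge` above). Rosser–Schoenfeld 1962, Thm. 12, prove `ψ(x) < 1.03883 x` unconditionally.
[cite: RosserSchoenfeld1962, Theorem 12] -/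
theorem psi_le_mul (hRH : RiemannHypothesis) {y : ℝ} (hy : 0 ≤ y) : ψ y ≤ 1.04 * y := by
  rcases le_or_gt y 10000 with h | h
  · exact psi_le_of_le_ten_thousand hy h
  · exact psi_le_mul_of_ge hRH h.le

/-- **Under RH, `ψ(x) − θ(x) ≤ 1.04 (√x + x^{1/3} + x^{1/5})` for `x ≥ 0`** (Mathlib's
`ψ(x) − θ(x) ≤ ψ(x^{1/2}) + ψ(x^{1/3}) + ψ(x^{1/5})` and `psi_le_mul`). [cite: RosserSchoenfeld1962, (3.39)] -/
theorem psi_sub_theta_le (hRH : RiemannHypothesis) {x : ℝ} (hx : 0 ≤ x) :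
    ψ x - θ x ≤ 1.04 * (Real.sqrt x + x ^ (1 / 3 : ℝ) + x ^ (1 / 5 : ℝ)) := by
  have h := Chebyshev.psi_sub_theta_le_psi_add_psi_add_psi x
  have e2 : x ^ (2 : ℝ)⁻¹ = Real.sqrt x := by rw [Real.sqrt_eq_rpow]; norm_num
  have e3 : x ^ (3 : ℝ)⁻¹ = x ^ (1 / 3 : ℝ) := by norm_num
  have e5 : x ^ (5 : ℝ)⁻¹ = x ^ (1 / 5 : ℝ) := by norm_num
  rw [e2, e3, e5] at h
  have h1 := psi_le_mul hRH (Real.sqrt_nonneg x)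
  have h2 := psi_le_mul hRH (Real.rpow_nonneg hx (1 / 3))
  have h3 := psi_le_mul hRH (Real.rpow_nonneg hx (1 / 5))
  linarith

end SchoenfeldBound

end Literature.NumberTheory.LFunctions

end
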